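import Literature.Geometry.Riemannian.PinchingEstimatesReduction5
import Literature.Geometry.Riemannian.PinchingEstimatesImprovingQ
import HarnessLib

/-!
# Chen–Zhu's Lemma 2.1 reduced to the maximum principle for the curvature ODE alone
(topic `Geometry/Riemannian`)

Part of the decomposition of `Literature.Geometry.Riemannian.hamilton_chenZhu_pinching`
(`PinchingEstimates.lean`; Chen–Zhu 2006, Lemma 2.1 = Hamilton 1997, Thm. B1.1 + Thm. B2.3).
With the ODE parts of all of Hamilton's invariance theorems now PROVED in the tree
(Thms. 1.2, 1.3, 1.4, 1.6, 1.7, 1.9: `PinchingEstimatesPreserved/TwoSingular/TwoLargest/Largest/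
Singular.lean`; Thm. 2.1 with Lemma 2.2: `PinchingEstimatesImproving.lean`; Thm. 2.3:
`PinchingEstimatesImprovingQ.lean`), together with Cors. 1.5, 1.8, the convexity and closedness
of the pinching sets, the compactness statements at `t = 0` and the assembly, the named fact
`hamilton_chenZhu_pinching` is reduced to exactly ONE published ingredient that the tree does
not yet prove:

* `hamilton_chenZhu_pinching_of_maximumPrinciple` — `hamilton_maximumPrinciple_curvatureODE`
  (Hamilton 1986, Thm. 4.3, the maximum principle for systems applied to the curvature ODE
  `∂M/∂t = ΔM + M² + M^#` of the Ricci flow; Chow–Lu 2004, Thm. 3 for time-dependent sets)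
  implies `hamilton_chenZhu_pinching`.

## References

* R. S. Hamilton, Comm. Anal. Geom. 5 (1997), §2 (Thm. 1.1 and its proof, pp. 7–21). [Hamilton1997]
* R. S. Hamilton, J. Differential Geom. 24 (1986), §4, Thm. 4.3. [Hamilton1986]
* B. Chow, P. Lu, Pacific J. Math. 214 (2004), Thm. 3. [ChowLu2004]
* B.-L. Chen, X.-P. Zhu, J. Differential Geom. 74 (2006), §2, Lemma 2.1. [ChenZhu2006]
-/

noncomputable section

namespace Literature.Geometry.Riemannian

open HamiltonODE

universe u

/-- **Chen–Zhu 2006, Lemma 2.1 (= Hamilton 1997, Thm. B1.1 + Thm. B2.3) from Hamilton's maximum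
principle for the curvature ODE**: the whole of Hamilton's §2.1–2.2 ODE analysis being proved,
the pinching estimate follows from the tensor maximum principle alone.
[cite: ChenZhu2006, §2, Lemma 2.1] [cite: Hamilton1997, §2, Thm. 1.1 (proof, pp. 7–21)] -/
theorem hamilton_chenZhu_pinching_of_maximumPrinciple
    (hMP : hamilton_maximumPrinciple_curvatureODE.{u}) : hamilton_chenZhu_pinching.{u} :=
  hamilton_chenZhu_pinching_of_ode₁ hMP hamilton1997_B23_ode

end Literature.Geometry.Riemannian

end
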